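import Literature.MathematicalPhysics.QuantumFieldTheory.Balaban1983to89.B9Thm311DeltaANotUnitWitness
import Literature.MathematicalPhysics.QuantumFieldTheory.Balaban1983to89.B9Eq335CoveragePAtLettersY

/-!
# Balaban [B9], (3.35) p. 396 vs. the half-frustrated witness of `B9Thm311DeltaANotUnitWitness`: THE WITNESS LIES OUTSIDE THE CLASS
# (3.35) OF RECORD — consistency with Theorem 3.11 p. 416, made formal

T. Bałaban, *Propagators for lattice gauge theories in a background field*, Commun. Math. Phys. **99** (1985) 389–434
[`Balaban1985BackgroundPropagators`, "B9"].

statement-level skeleton of published theorems with citation tags; proofs where landed; nothing here is a claim about the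
Yang–Mills mass gap

THE PRINTED LOCUS.  (3.35) p. 396 (the regularity class: on each class cube a gauge with `U^u = e^{iηA}`, `|A| < O(1)Mα₀(Lʲη)⁻¹`, …) and its
consequence (3.69) p. 404 (the plaquette estimates `|Re U(∂p) − 1| ≤ …`, `|Im U(∂p)| ≤ …`, of which print says *«the estimates follow directly from the
assumptions (3.35), (3.37)»*); Thm 3.11 p. 416 (positivity, hence
invertibility, of `Δ_a(U)` on the class).

WHY THIS FILE (cell `pub-ymgap`, seat dag-n06-j gen 30; companion of `B9Thm311DeltaANotUnitWitness`, same day; count-neutral).  The companion file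
exhibits, at every member, an `SU(N)`-valued background `W` (the half-frustrated background, every plaquette holonomy `diag(i, −i, 1, …)^{±1}`) at which
NODE 00's `Δ_a(W)` is NOT a unit; its HONEST SCOPE paragraph says the witness lies OUTSIDE the class (3.35), "as it must".  THIS FILE proves that sentence
at the N06 certificate's literal class `(bg9YP (M_N(ℂ)) G x).Reg335 c35Y α₀` in the small-field regime `10·L·(M·α₀) ≤ 1/8`: by this seat's levelled
plaquette bound `B9Eq335CoveragePAtLettersY.norm_holY_sub_one_le_levelled_of_regYP335_c35Y` every member of the class has `|U(∂p) − 1| ≤ 2K(1+K)e^{4K} < 1`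
(`K = 10L·Mα₀ ≤ 1/8`) on EVERY plaquette, whereas the witness has `|W(∂p) − 1| ≥ |i − 1| = √2` on every plaquette.  So the kernel certificate and
Theorem 3.11 live on disjoint sets of backgrounds, and the companion's negation of the displayed binder "`Δ_a(U)` a unit at every `G`-valued `U`" (this seat's words for the typed `hunitA`) is
exactly a statement about backgrounds print never feeds to (3.27).

WHAT IS PROVED (kernel-checked, 0 sorry, 0 def).  `sqrt_two_le_norm_gSU_sub_one` ∕ `sqrt_two_le_norm_gSU_inv_sub_one` (`‖g^{±1} − 1‖ ≥ √2`, entry test),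
★ `sqrt_two_le_norm_holY_halfCfg_sub_one` (every plaquette of the witness), `plaqBound_lt_one` (`K ≤ 1/8 ⇒ 2K(1+K)e^{4K}·(L^{j−1})⁻² < 1`),
★★★ `halfCfg_not_mem_regYP335` (`d + 1 ≥ 2`, `N ≥ 1`, `α₀ ≥ 0`, `10L·Mα₀ ≤ 1/8`: the witness is NOT in `(bg9YP … x).Reg335 c35Y α₀`),
★★ `exists_su_not_mem_regYP335_not_isUnit_deltaAY` (the companion's ∃-statement with the class exclusion recorded).

HONEST SCOPE.  Finite-dimensional bookkeeping on landed theorems; the threshold `1/8` is a convenient sufficient constant (any `K` with `2K(1+K)e^{4K} < √2`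
would do), not print's; nothing of [B9] asserted; count-neutral; N06 NOT discharged; nothing continuum ∕ OS ∕ mass-gap ∕ Clay.  No `sorry`, no `axiom`,
no `instance`, no `notation`.  `--supports stmt-QuantumFields-27364`.
-/

noncomputable section

namespace Literature.MathematicalPhysics.QuantumFieldTheory.Balaban1983to89.B9Thm311DeltaANotUnitWitnessOffClass

open Literature.MathematicalPhysics.QuantumFieldTheory.Balaban1983to89
open Literature.MathematicalPhysics.QuantumFieldTheory.Balaban1983to89.B9Thm311DeltaANotUnitWitness (halfCfg gSU suDiag holY_halfCfg halfCfg_mem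
  gSU_mem_specialUnitaryUnits not_isUnit_deltaAY_halfCfg_parBY GAY_halfCfg_parBY_eq_zero eSU_ne_zero commute_eSU_gSU eSU_mul_gSU_add_inv)
open Literature.MathematicalPhysics.QuantumFieldTheory.Balaban1983to89.B9Eq335CoveragePAtLettersY (norm_holY_sub_one_le_levelled_of_regYP335_c35Y)
open Literature.MathematicalPhysics.QuantumFieldTheory.Balaban1983to89.B9Eq335PlaquetteAtLettersY (one_le_L)
open Literature.MathematicalPhysics.QuantumFieldTheory.Balaban1983to89.B7Prop2SpecialUnitary (specialUnitaryUnits)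
open Node00 B6KLevelCensusIndexV1 B9BackgroundsKLevelV1 B6GlobalChartV1 B9BackgroundsKLevelV1P B9PinMembersKLevelV1 B9PinGeometryKLevelV1
open scoped Matrix Matrix.Norms.L2Operator

variable {N : ℕ}

/-! ## §1 The witness holonomies are far from `1`: `‖g^{±1} − 1‖ ≥ √2` -/

/-- an entry is bounded by the `L²`-operator norm (test against a basis vector). [folklore] -/
private theorem norm_entry_le_l2_opNorm (A : Matrix (Fin N) (Fin N) ℂ) (a a' : Fin N) : ‖A a a'‖ ≤ ‖A‖ := by
  have h := Matrix.l2_opNorm_mulVec A (EuclideanSpace.single a' (1 : ℂ))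
  have h1 : ‖(EuclideanSpace.single a' (1 : ℂ))‖ = 1 := by simp
  rw [h1, mul_one] at h
  refine le_trans ?_ h
  refine le_trans (le_of_eq ?_) (PiLp.norm_apply_le _ a)
  simp

/-- `‖±i − 1‖ = √2`. [folklore] -/
private theorem sqrt_two_eq_norm_of_sq {z : ℂ} (hz : ‖z‖ ^ 2 = 2) : Real.sqrt 2 = ‖z‖ := by
  rw [← hz, Real.sqrt_sq (norm_nonneg _)]

/-- `‖diag(i, −i, 1, …) − 1‖ ≥ √2` (its `(0,0)` entry is `i − 1`). [cite: Balaban1985BackgroundPropagators, (3.35) p.396 (U(∂p) near 1 in the class), bookkeeping] -/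
theorem sqrt_two_le_norm_gSU_sub_one (hN : 1 ≤ N) : Real.sqrt 2 ≤ ‖(gSU N : Matrix (Fin N) (Fin N) ℂ) - 1‖ := by
  have h00 : ((gSU N : Matrix (Fin N) (Fin N) ℂ) - 1) ⟨0, hN⟩ ⟨0, hN⟩ = Complex.I - 1 := by
    show (Matrix.diagonal (suDiag N) - 1) ⟨0, hN⟩ ⟨0, hN⟩ = Complex.I - 1
    rw [Matrix.sub_apply, Matrix.diagonal_apply_eq, Matrix.one_apply_eq]
    simp [suDiag]
  have hsq : ‖Complex.I - 1‖ ^ 2 = 2 := by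
    rw [Complex.sq_norm, Complex.normSq_apply]
    simp
    norm_num
  calc Real.sqrt 2 = ‖Complex.I - 1‖ := sqrt_two_eq_norm_of_sq hsq
    _ = ‖((gSU N : Matrix (Fin N) (Fin N) ℂ) - 1) ⟨0, hN⟩ ⟨0, hN⟩‖ := by rw [h00]
    _ ≤ _ := norm_entry_le_l2_opNorm _ _ _

/-- `‖diag(i, −i, 1, …)⁻¹ − 1‖ ≥ √2` (its `(0,0)` entry is `−i − 1`). [cite: Balaban1985BackgroundPropagators, (3.35) p.396, bookkeeping] -/
theorem sqrt_two_le_norm_gSU_inv_sub_one (hN : 1 ≤ N) : Real.sqrt 2 ≤ ‖(((gSU N)⁻¹ : (Matrix (Fin N) (Fin N) ℂ)ˣ) : Matrix (Fin N) (Fin N) ℂ) - 1‖ := by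
  have h00 : ((((gSU N)⁻¹ : (Matrix (Fin N) (Fin N) ℂ)ˣ) : Matrix (Fin N) (Fin N) ℂ) - 1) ⟨0, hN⟩ ⟨0, hN⟩ = -Complex.I - 1 := by
    show (Matrix.diagonal (star (suDiag N)) - 1) ⟨0, hN⟩ ⟨0, hN⟩ = -Complex.I - 1
    rw [Matrix.sub_apply, Matrix.diagonal_apply_eq, Matrix.one_apply_eq, Pi.star_apply]
    simp [suDiag]
  have hsq : ‖-Complex.I - 1‖ ^ 2 = 2 := by
    rw [Complex.sq_norm, Complex.normSq_apply]
    simp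
    norm_num
  calc Real.sqrt 2 = ‖-Complex.I - 1‖ := sqrt_two_eq_norm_of_sq hsq
    _ = ‖((((gSU N)⁻¹ : (Matrix (Fin N) (Fin N) ℂ)ˣ) : Matrix (Fin N) (Fin N) ℂ) - 1) ⟨0, hN⟩ ⟨0, hN⟩‖ := by rw [h00]
    _ ≤ _ := norm_entry_le_l2_opNorm _ _ _

variable {d ℓ : ℕ} {hd : 1 ≤ d + 1} {hL : Odd (ℓ + 1) ∧ 1 < ℓ + 1} {b₀ b₁ : ℝ} {Mstar : ℕ}

/-- ★ **EVERY PLAQUETTE OF THE WITNESS IS FAR FROM FLAT**: `‖W(∂p) − 1‖ ≥ √2`. [cite: Balaban1985BackgroundPropagators, (3.35) p.396, (3.69) p.404 (the class forces U(∂p) near 1)] -/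
theorem sqrt_two_le_norm_holY_halfCfg_sub_one (i : KIdx d ℓ hd hL b₀ b₁) (hN : 1 ≤ N) (p : PlaqY i) :
    Real.sqrt 2 ≤ ‖((holY i (halfCfg i (gSU N)) p : (Matrix (Fin N) (Fin N) ℂ)ˣ) : Matrix (Fin N) (Fin N) ℂ) - 1‖ := by
  rcases holY_halfCfg i (gSU N) p with h | h
  · rw [h]; exact sqrt_two_le_norm_gSU_sub_one hN
  · rw [h]; exact sqrt_two_le_norm_gSU_inv_sub_one hN

/-! ## §2 In the class every plaquette is near flat; the witness is outside the class -/

/-- the levelled (3.69) constant is `< 1` in the regime `K = 10L·Mα₀ ≤ 1/8` (`2K(1+K)e^{4K} ≤ (9/32)e^{1/2} < 1`, times `(L^{j−1})⁻² ≤ 1`).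
[cite: Balaban1985BackgroundPropagators, (3.69) p.404, bookkeeping] -/
theorem plaqBound_lt_one {K L : ℝ} (hK0 : 0 ≤ K) (hK : K ≤ 1 / 8) (hL : 1 ≤ L) (n : ℕ) :
    2 * K * (1 + K) * Real.exp (4 * K) * ((L ^ n)⁻¹) ^ 2 < 1 := by
  have hexp : Real.exp (4 * K) < 3 := by
    calc Real.exp (4 * K) ≤ Real.exp 1 := Real.exp_le_exp.mpr (by linarith)
      _ < 3 := lt_trans Real.exp_one_lt_d9 (by norm_num)
  have hpow : 1 ≤ L ^ n := one_le_pow₀ hL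
  have hinv : (L ^ n)⁻¹ ≤ 1 := inv_le_one_of_one_le₀ hpow
  have hinv0 : 0 ≤ (L ^ n)⁻¹ := inv_nonneg.mpr (le_trans zero_le_one hpow)
  have hsq : ((L ^ n)⁻¹) ^ 2 ≤ 1 := by
    rw [sq]
    exact mul_le_one₀ hinv hinv0 hinv
  have hA : 2 * K * (1 + K) * Real.exp (4 * K) ≤ 2 * (1 / 8) * (1 + 1 / 8) * 3 := by
    have h1 : 2 * K * (1 + K) ≤ 2 * (1 / 8) * (1 + 1 / 8) := by nlinarith
    have h2 : 0 ≤ 2 * K * (1 + K) := by positivity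
    exact mul_le_mul h1 hexp.le (Real.exp_pos _).le (by norm_num)
  have hA0 : 0 ≤ 2 * K * (1 + K) * Real.exp (4 * K) := by positivity
  calc 2 * K * (1 + K) * Real.exp (4 * K) * ((L ^ n)⁻¹) ^ 2 ≤ 2 * (1 / 8) * (1 + 1 / 8) * 3 * 1 :=
        mul_le_mul hA hsq (sq_nonneg _) (by norm_num)
    _ < 1 := by norm_num

/-- ★★★ **THE HALF-FRUSTRATED WITNESS IS OUTSIDE THE CLASS (3.35) OF RECORD** `(bg9YP (M_N(ℂ)) G x).Reg335 c35Y α₀` in the regime `10L·(Mα₀) ≤ 1/8`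
(`α₀ ≥ 0`, dimension `d + 1 ≥ 2`, `N ≥ 1`, any `G`): in the class every plaquette has `|U(∂p) − 1| < 1`, the witness has `|W(∂p) − 1| ≥ √2`.
[cite: Balaban1985BackgroundPropagators, (3.35) p.396, (3.69) p.404, Thm 3.11 p.416] -/
theorem halfCfg_not_mem_regYP335 (x : MemberY d ℓ hd hL b₀ b₁ Mstar) (hd1 : 1 ≤ d) (hN : 1 ≤ N) {G : Subgroup (Matrix (Fin N) (Fin N) ℂ)ˣ}
    {α₀ : ℝ} (hα₀ : 0 ≤ α₀) (hK : 10 * (kGeo x.toKIdx).L * ((kGeo x.toKIdx).M * α₀) ≤ 1 / 8) :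
    ¬ (bg9YP (Matrix (Fin N) (Fin N) ℂ) G x).Reg335 c35Y α₀ (halfCfg x.toKIdx (gSU N)) := by
  intro h
  haveI : Nonempty (Fin N) := ⟨⟨0, hN⟩⟩
  let p : PlaqY x.toKIdx := ⟨default, ⟨0, by show 0 < d + 1; omega⟩, ⟨1, by show 1 < d + 1; omega⟩, by show (0 : ℕ) < 1; omega⟩
  have hM : 0 ≤ (kGeo x.toKIdx).M := by
    show 0 ≤ ((ℓ + 1 : ℕ) : ℝ) * (x.toKIdx.Mh : ℝ)
    positivity
  have hK0 : 0 ≤ 10 * (kGeo x.toKIdx).L * ((kGeo x.toKIdx).M * α₀) :=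
    mul_nonneg (mul_nonneg (by norm_num) (le_trans zero_le_one (one_le_L x.toKIdx))) (mul_nonneg hM hα₀)
  have hle := norm_holY_sub_one_le_levelled_of_regYP335_c35Y x hα₀ h p
  have hlt := plaqBound_lt_one hK0 hK (one_le_L x.toKIdx) (levV1 x.toKIdx p.src - 1)
  have hge := sqrt_two_le_norm_holY_halfCfg_sub_one x.toKIdx hN p
  have h2 : (1 : ℝ) < Real.sqrt 2 := by
    rw [show (1 : ℝ) = Real.sqrt 1 from Real.sqrt_one.symm]
    exact Real.sqrt_lt_sqrt (by norm_num) (by norm_num)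
  linarith

/-- ★★ the companion's ∃-statement with the class exclusion recorded: an `SU(N)`-valued background OUTSIDE (3.35) (regime `10L·Mα₀ ≤ 1/8`) at which
`Δ_a(U)` is not a unit and `G(U) = 0` (def-Y's `parBY`; any `parS`, `Gp`; `d + 1 ≥ 2`, `N ≥ 2`). [cite: Balaban1985BackgroundPropagators, Thm 3.11 p.416, (3.26)–(3.27) p.395, (3.35) p.396] -/
theorem exists_su_not_mem_regYP335_not_isUnit_deltaAY (x : MemberY d ℓ hd hL b₀ b₁ Mstar) (hd1 : 1 ≤ d) (hN : 2 ≤ N)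
    {G : Subgroup (Matrix (Fin N) (Fin N) ℂ)ˣ} {α₀ : ℝ} (hα₀ : 0 ≤ α₀) (hK : 10 * (kGeo x.toKIdx).L * ((kGeo x.toKIdx).M * α₀) ≤ 1 / 8)
    (parS : SiteParY (Matrix (Fin N) (Fin N) ℂ) x.toKIdx) (Gp : SiteOpY (Matrix (Fin N) (Fin N) ℂ) x.toKIdx) :
    ∃ U : CfgY (Matrix (Fin N) (Fin N) ℂ) x.toKIdx, (∀ μ y, U μ y ∈ specialUnitaryUnits (Fin N))
      ∧ ¬ (bg9YP (Matrix (Fin N) (Fin N) ℂ) G x).Reg335 c35Y α₀ U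
      ∧ ¬ IsUnit (deltaAY x.toKIdx parS (parBY x.toKIdx) Gp U) ∧ GAY x.toKIdx parS (parBY x.toKIdx) Gp U = 0 :=
  ⟨halfCfg x.toKIdx (gSU N), halfCfg_mem x.toKIdx (gSU N) (gSU_mem_specialUnitaryUnits hN), halfCfg_not_mem_regYP335 x hd1 (by omega) hα₀ hK,
    not_isUnit_deltaAY_halfCfg_parBY x.toKIdx hd1 (eSU_ne_zero (by omega)) commute_eSU_gSU eSU_mul_gSU_add_inv parS Gp,
    GAY_halfCfg_parBY_eq_zero x.toKIdx hd1 (eSU_ne_zero (by omega)) commute_eSU_gSU eSU_mul_gSU_add_inv parS Gp⟩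

end Literature.MathematicalPhysics.QuantumFieldTheory.Balaban1983to89.B9Thm311DeltaANotUnitWitnessOffClass

end
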